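import Mathlib
import Summits.Ventures.HodgeRepro2.Tier7.Line3.TwoVectorProjector
import Summits.Ventures.HodgeRepro2.Tier7.Line3.TwoVectorSpectralSum

/-!
# Tier7/Line3/TwoVectorIsotypic — the spectral side of `R(f)` for the two-vector `f` on the whole space,
with the isotypic decomposition as the ONLY hypothesis (seat t7-L1-p2, gen 4)

LINE 3 (t7-plan-3), version (ii), memo v15 §2g′ (1) (STATUS l. 15352): «on each copy of `π⁰_v`, `R(f_v) φ =
⟨φ, u_B⟩ u_A` (rank one) and `R(f_v) = 0` on every `σ ≇ π⁰_v`; so `R(f)` is of FINITE RANK on the level-`K_f`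
forms … and the archimedean factor of the spectral side per copy is `P_A(u_A) · conj P_B(u_B)`».
`TwoVectorProjector` (p681253) proves the per-copy rank-one formula and the vanishing on `σ ≇ τ` on the WHOLE
representation space `H`; `TwoVectorSpectralSum` (p683077) sums the rank-one maps over finitely many copies but
takes «`T` is rank one on each copy» and «`T = 0` on the orthogonal complement» as HYPOTHESES. THIS FILE composes
the two: for the two-vector `f = mc τ b a` (`OneVectorProjector.mc τ b a g = d · ⟪τ g b, a⟫`, `d = dim τ`) and ANY
unitary strongly continuous representation `π` of the compact group `G` on a Hilbert space `H`, given finitely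
many pairwise orthogonal EQUIVARIANT ISOMETRIC copies `ι l : V →ₗ[ℂ] H` of the irreducible `τ`, with
`K = ⨆ l, range (ι l)`, and the ISOTYPIC-COMPLETENESS clause «every equivariant `V →ₗ[ℂ] H` with values in `Kᗮ`
is `0`» (= the copies are ALL the copies of `τ` in `H`; in the application the printed finite multiplicity,
GH 18.2.2 / DE 9.2.2):

* `integratedForm_mem_orthogonal`: the integrated form of ANY integrable `f` preserves the orthogonal complement
  of a `π`-stable subspace (`⟪u, R(f) x⟫ = ∫ f(g) ⟪π(g⁻¹) u, x⟫ = 0`);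
* `isStable_iSup_range`: `K` is `π`-stable; `PhiFun_mem_orthogonal`: `PhiLM b x` takes values in `Kᗮ` for
  `x ∈ Kᗮ`;
* **`integratedForm_two_eq_zero_of_mem_orthogonal`**: `R(f) x = 0` for `x ∈ Kᗮ` — DERIVED from the completeness
  clause (`PhiLM b x` is equivariant with values in `Kᗮ`, hence `0`, and `R(f) x = PhiLM b x a`); no Schur needed;
  `isotypicComplete_of_forall_copy_le`: the clause follows (Schur) from «every injective equivariant `V →ₗ[ℂ] H`
  has range in `K`» — i.e. the `ι l` exhaust the copies of `τ` in `H`;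
* **`RopTwo_eq_sum_rankOne`**: `R(f) = ∑ l, rankOne (ι l b) (ι l a)` as a bounded operator on `H`
  (p4's `eq_sum_rankOne_of_copies_of_zero_orthogonal` fed with `integratedForm_two_map_eq` and the vanishing);
* **`doublePeriod_RopTwo_eq_sum`**: `doublePeriod R(f) P Q = ∑ l, P (ι l a) · conj (Q (ι l b))` for every pair of
  continuous functionals `P Q` on `H` — the memo's spectral side over the copies, now a theorem about the actual
  `R(f)`; **`exists_both_ne_zero_of_doublePeriod_RopTwo_ne_zero`**: if it is non-zero, SOME copy has both periods
  non-zero; `range_RopTwo_le_span`: the range of `R(f)` lies in the span of the `ι l a` (finite rank).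

What it shrinks: `TwoVectorSpectralSum`'s in-words clause «`R(f_v)` acts on each copy as the rank-one map (Schur
at `ι₁`)» is now a theorem on the whole space with the isotypic decomposition as the only hypothesis — the
abstract §2f `identity` row at the compact place. What stays in words: WHICH Hilbert space, which copies and
INPUT G at `ι₂`, `ι₃` (the dictionary, TYPING-CENSUS T7). Nothing here is about an adelic group, a period of an
automorphic form, (N) or (P); no device. No sorry; axioms ⊆ {propext, Classical.choice, Quot.sound}.
-/

namespace Summit.Ventures.HodgeRepro2.Tier7.Line3.TwoVectorIsotypic

open MeasureTheory
open scoped InnerProductSpace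
open Summit.Ventures.HodgeRepro2.T7SupportIntegratedForm (integratedForm integratedFormCLM integratedFormCLM_apply
  inner_apply_left)
open Summit.Ventures.HodgeRepro2.Tier7.Line3.SchurProjector (IsIrreducible rankOne rankOne_apply)
open Summit.Ventures.HodgeRepro2.Tier7.Line3.OneVectorProjector
open Summit.Ventures.HodgeRepro2.Tier7.Line3.TwoVectorProjector
open Summit.Ventures.HodgeRepro2.Tier7.Line3.TwoVectorSpectralSum

variable {G : Type*} [Group G] [TopologicalSpace G] [IsTopologicalGroup G] [CompactSpace G]
  [MeasurableSpace G] [BorelSpace G] (μ : Measure G)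
variable {V : Type*} [NormedAddCommGroup V] [InnerProductSpace ℂ V] [FiniteDimensional ℂ V] [CompleteSpace V]
variable {H : Type*} [NormedAddCommGroup H] [InnerProductSpace ℂ H] [CompleteSpace H]

section Stable

omit [IsTopologicalGroup G] [FiniteDimensional ℂ V] [CompleteSpace V] in
/-- **the integrated form preserves the orthogonal complement of a `π`-stable subspace**: for `π` unitary and
strongly continuous, `f` integrable, `K` with `π g K ⊆ K` for all `g`, and `x ∈ Kᗮ`, `R(f) x ∈ Kᗮ`
(`⟪u, R(f) x⟫ = ∫ f(g) ⟪π(g⁻¹) u, x⟫ dμ = 0`). -/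
theorem integratedForm_mem_orthogonal {π : G →* (H →ₗ[ℂ] H)}
    (hπ : T7SupportWeightTorusOrbital.IsUnitaryRep π) (hc : ∀ x, Continuous fun g => π g x) {f : G → ℂ}
    (hf : Integrable f μ) (K : Submodule ℂ H) (hK : ∀ g, ∀ u ∈ K, π g u ∈ K) {x : H} (hx : x ∈ Kᗮ) :
    integratedForm μ π f x ∈ Kᗮ := by
  rw [Submodule.mem_orthogonal]
  intro u hu
  unfold integratedForm
  have hint : Integrable (fun g => f g • π g x) μ :=
    T7SupportIntegratedForm.integrable_smul μ hπ (isStronglyMeasurable_of_continuous μ hc) hf x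
  rw [← integral_inner hint u]
  refine integral_eq_zero_of_ae (Filter.Eventually.of_forall fun g => ?_)
  show ⟪u, f g • π g x⟫_ℂ = 0
  rw [inner_smul_right, ← inner_conj_symm, inner_apply_left hπ g x u, inner_conj_symm,
    (Submodule.mem_orthogonal K x).1 hx (π g⁻¹ u) (hK g⁻¹ u hu), mul_zero]

omit [TopologicalSpace G] [IsTopologicalGroup G] [CompactSpace G] [MeasurableSpace G] [BorelSpace G]
  [FiniteDimensional ℂ V] [CompleteSpace V] [CompleteSpace H] in
/-- the sum `K = ⨆ l, range (ι l)` of the ranges of equivariant maps `ι l : V →ₗ[ℂ] H` is `π`-stable. -/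
theorem isStable_iSup_range {π : G →* (H →ₗ[ℂ] H)} {τ : G →* (V →L[ℂ] V)} {L : Type*}
    (ι : L → (V →ₗ[ℂ] H)) (hι : ∀ l g v, ι l (τ g v) = π g (ι l v)) (g : G) :
    ∀ u ∈ ⨆ l, LinearMap.range (ι l), π g u ∈ ⨆ l, LinearMap.range (ι l) := by
  intro u hu
  have hmap : Submodule.map (π g) (⨆ l, LinearMap.range (ι l)) ≤ ⨆ l, LinearMap.range (ι l) := by
    rw [Submodule.map_iSup]
    refine iSup_le fun l => le_trans ?_ (le_iSup (fun l => LinearMap.range (ι l)) l)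
    rintro y ⟨z, ⟨v, rfl⟩, rfl⟩
    exact ⟨τ g v, hι l g v⟩
  exact hmap ⟨u, hu, rfl⟩

end Stable

section Vanishing

omit [IsTopologicalGroup G] [FiniteDimensional ℂ V] [CompleteSpace V] in
/-- `PhiLM b x` takes its values in `Kᗮ` when `x ∈ Kᗮ` and `K` is `π`-stable. -/
theorem PhiFun_mem_orthogonal [IsFiniteMeasure μ] {τ : G →* (V →L[ℂ] V)} (hτ : Continuous τ)
    {π : G →* (H →ₗ[ℂ] H)} (hπ : T7SupportWeightTorusOrbital.IsUnitaryRep π)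
    (hc : ∀ x, Continuous fun g => π g x) (K : Submodule ℂ H) (hK : ∀ g, ∀ u ∈ K, π g u ∈ K) (b : V) {x : H}
    (hx : x ∈ Kᗮ) (w : V) : PhiFun μ π τ b x w ∈ Kᗮ :=
  integratedForm_mem_orthogonal μ hπ hc (integrable_mc μ hτ b w) K hK hx

omit [FiniteDimensional ℂ V] [CompleteSpace V] in
/-- **`R(f) x = 0` on the orthogonal complement of the isotypic part**: if `K` is `π`-stable and every
equivariant `e : V →ₗ[ℂ] H` with values in `Kᗮ` is `0` (no copy of `τ` in `Kᗮ`), then `R(mc τ b a) x = 0` for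
`x ∈ Kᗮ` — because `R(f) x = PhiLM b x a` and `PhiLM b x` is such an `e`. -/
theorem integratedForm_two_eq_zero_of_mem_orthogonal [IsFiniteMeasure μ] [μ.IsMulLeftInvariant]
    {τ : G →* (V →L[ℂ] V)} (hτ : Continuous τ) (hτu : SchurProjector.IsUnitaryRep τ) {π : G →* (H →ₗ[ℂ] H)}
    (hπ : T7SupportWeightTorusOrbital.IsUnitaryRep π) (hc : ∀ x, Continuous fun g => π g x)
    (K : Submodule ℂ H) (hK : ∀ g, ∀ u ∈ K, π g u ∈ K)
    (hiso : ∀ e : V →ₗ[ℂ] H, (∀ g v, e (τ g v) = π g (e v)) → (∀ v, e v ∈ Kᗮ) → e = 0) (b a : V) {x : H}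
    (hx : x ∈ Kᗮ) : integratedForm μ π (mc τ b a) x = 0 := by
  have h0 : PhiLM μ hτ hπ hc b x = 0 :=
    hiso _ (fun g v => by rw [PhiLM_apply, PhiLM_apply, pi_PhiFun μ hτ hτu hπ hc b x g v])
      (fun v => PhiFun_mem_orthogonal μ hτ hπ hc K hK b hx v)
  rw [integratedForm_two_eq_PhiFun, ← PhiLM_apply μ hτ hπ hc, h0, LinearMap.zero_apply]

omit [TopologicalSpace G] [IsTopologicalGroup G] [CompactSpace G] [MeasurableSpace G] [BorelSpace G]
  [FiniteDimensional ℂ V] [CompleteSpace V] [CompleteSpace H] in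
/-- **the completeness clause from «every copy of `τ` in `H` lies in `K`»** (Schur): for irreducible `τ` an
equivariant `e : V →ₗ[ℂ] H` is `0` or injective (its kernel is `τ`-stable); if every injective equivariant map
has range `≤ K`, an equivariant map with values in `Kᗮ` is `0` (`K ⊓ Kᗮ = ⊥`). -/
theorem isotypicComplete_of_forall_copy_le {τ : G →* (V →L[ℂ] V)} (hτi : IsIrreducible τ)
    {π : G →* (H →ₗ[ℂ] H)} (K : Submodule ℂ H)
    (hcopy : ∀ e : V →ₗ[ℂ] H, (∀ g v, e (τ g v) = π g (e v)) → Function.Injective e → LinearMap.range e ≤ K)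
    (e : V →ₗ[ℂ] H) (he : ∀ g v, e (τ g v) = π g (e v)) (hK : ∀ v, e v ∈ Kᗮ) : e = 0 := by
  have hst : SchurProjector.IsStable τ (LinearMap.ker e) := by
    intro g v hv
    rw [LinearMap.mem_ker] at hv ⊢
    rw [he, hv, map_zero]
  rcases hτi.eq_bot_or_eq_top _ hst with h | h
  · have hinj : Function.Injective e := LinearMap.ker_eq_bot.1 h
    ext v
    have hmem : e v ∈ K ⊓ Kᗮ := ⟨hcopy e he hinj ⟨v, rfl⟩, hK v⟩
    rw [Submodule.inf_orthogonal_eq_bot] at hmem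
    rw [LinearMap.zero_apply]
    exact (Submodule.mem_bot ℂ).1 hmem
  · ext v
    have hv : v ∈ LinearMap.ker e := by
      rw [h]
      exact Submodule.mem_top
    rw [LinearMap.zero_apply]
    exact LinearMap.mem_ker.1 hv

end Vanishing

section Copies

variable {L : Type*} [Fintype L]

omit [TopologicalSpace G] [IsTopologicalGroup G] [CompactSpace G] [MeasurableSpace G] [BorelSpace G]
  [CompleteSpace V] [CompleteSpace H] in
/-- the sum `K = ⨆ l, range (ι l)` of finitely many finite-dimensional ranges is finite-dimensional. -/
theorem finiteDimensional_iSup_range (ι : L → (V →ₗ[ℂ] H)) :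
    FiniteDimensional ℂ (⨆ l, LinearMap.range (ι l) : Submodule ℂ H) :=
  Submodule.finiteDimensional_iSup _

omit [TopologicalSpace G] [IsTopologicalGroup G] [CompactSpace G] [MeasurableSpace G] [BorelSpace G]
  [CompleteSpace V] [CompleteSpace H] in
/-- hence `K` has an orthogonal projection (it is complete). -/
theorem hasOrthogonalProjection_iSup_range (ι : L → (V →ₗ[ℂ] H)) :
    (⨆ l, LinearMap.range (ι l) : Submodule ℂ H).HasOrthogonalProjection := by
  haveI := finiteDimensional_iSup_range ι
  haveI : CompleteSpace (⨆ l, LinearMap.range (ι l) : Submodule ℂ H) := FiniteDimensional.complete ℂ _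
  exact Submodule.HasOrthogonalProjection.ofCompleteSpace _

/-- **`R(f)` IS the sum of the rank-one maps of the copies**: for the two-vector `f = mc τ b a`, finitely many
pairwise orthogonal equivariant isometric copies `ι l : V →ₗ[ℂ] H` of the irreducible `τ`, and the
completeness clause «every equivariant `V →ₗ[ℂ] H` with values in `(⨆ l, range (ι l))ᗮ` is `0`»,
`R(f) = ∑ l, rankOne (ι l b) (ι l a)` as a bounded operator on `H`. -/
theorem RopTwo_eq_sum_rankOne [IsProbabilityMeasure μ] [μ.IsMulLeftInvariant] {τ : G →* (V →L[ℂ] V)}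
    (hτ : Continuous τ) (hτu : SchurProjector.IsUnitaryRep τ) (hτi : IsIrreducible τ) {π : G →* (H →ₗ[ℂ] H)}
    (hπ : T7SupportWeightTorusOrbital.IsUnitaryRep π) (hc : ∀ x, Continuous fun g => π g x)
    (ι : L → (V →ₗ[ℂ] H)) (hι : ∀ l g v, ι l (τ g v) = π g (ι l v))
    (hιn : ∀ l v w, ⟪ι l v, ι l w⟫_ℂ = ⟪v, w⟫_ℂ) (horth : ∀ l m, l ≠ m → ∀ v w, ⟪ι l v, ι m w⟫_ℂ = 0)
    (hiso : ∀ e : V →ₗ[ℂ] H, (∀ g v, e (τ g v) = π g (e v)) →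
      (∀ v, e v ∈ (⨆ l, LinearMap.range (ι l))ᗮ) → e = 0) (b a : V) :
    RopTwo μ hτ hπ hc b a = ∑ l, rankOne (ι l b) (ι l a) := by
  haveI := hasOrthogonalProjection_iSup_range ι
  refine eq_sum_rankOne_of_copies_of_zero_orthogonal (RopTwo μ hτ hπ hc b a) (fun l => LinearMap.range (ι l))
    (fun l => ι l b) (fun l => ι l a) (fun l => ⟨b, rfl⟩) ?_ ?_ ?_
  · rintro l m hlm x ⟨v, rfl⟩ y ⟨w, rfl⟩
    exact horth l m hlm v w
  · rintro l x ⟨v, rfl⟩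
    rw [RopTwo_apply, integratedForm_two_map_eq μ hτ hτu hτi b a (ι l) (hι l) v, hιn l b v]
  · intro x hx
    rw [RopTwo_apply]
    exact integratedForm_two_eq_zero_of_mem_orthogonal μ hτ hτu hπ hc _ (isStable_iSup_range ι hι) hiso b a hx


/-- **the spectral side of `R(f)` over the copies, for the actual `R(f)`**: under the hypotheses of
`RopTwo_eq_sum_rankOne`, `doublePeriod R(f) P Q = ∑ l, P (ι l a) · conj (Q (ι l b))` for every pair of continuous
functionals `P Q : H →L[ℂ] ℂ` — each copy contributes its `A`-period on `ι l a = u_A^l` times the conjugate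
`B`-period on `ι l b = u_B^l`. -/
theorem doublePeriod_RopTwo_eq_sum [IsProbabilityMeasure μ] [μ.IsMulLeftInvariant] {τ : G →* (V →L[ℂ] V)}
    (hτ : Continuous τ) (hτu : SchurProjector.IsUnitaryRep τ) (hτi : IsIrreducible τ) {π : G →* (H →ₗ[ℂ] H)}
    (hπ : T7SupportWeightTorusOrbital.IsUnitaryRep π) (hc : ∀ x, Continuous fun g => π g x)
    (ι : L → (V →ₗ[ℂ] H)) (hι : ∀ l g v, ι l (τ g v) = π g (ι l v))
    (hιn : ∀ l v w, ⟪ι l v, ι l w⟫_ℂ = ⟪v, w⟫_ℂ) (horth : ∀ l m, l ≠ m → ∀ v w, ⟪ι l v, ι m w⟫_ℂ = 0)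
    (hiso : ∀ e : V →ₗ[ℂ] H, (∀ g v, e (τ g v) = π g (e v)) →
      (∀ v, e v ∈ (⨆ l, LinearMap.range (ι l))ᗮ) → e = 0) (b a : V) (P Q : H →L[ℂ] ℂ) :
    TwoVectorPeriod.doublePeriod (RopTwo μ hτ hπ hc b a) P Q =
      ∑ l, P (ι l a) * (starRingEnd ℂ) (Q (ι l b)) := by
  rw [RopTwo_eq_sum_rankOne μ hτ hτu hτi hπ hc ι hι hιn horth hiso b a, doublePeriod_sum_rankOne]

/-- **a non-zero double period of `R(f)` gives a copy with BOTH periods non-zero**. -/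
theorem exists_both_ne_zero_of_doublePeriod_RopTwo_ne_zero [IsProbabilityMeasure μ] [μ.IsMulLeftInvariant]
    {τ : G →* (V →L[ℂ] V)} (hτ : Continuous τ) (hτu : SchurProjector.IsUnitaryRep τ) (hτi : IsIrreducible τ)
    {π : G →* (H →ₗ[ℂ] H)} (hπ : T7SupportWeightTorusOrbital.IsUnitaryRep π)
    (hc : ∀ x, Continuous fun g => π g x) (ι : L → (V →ₗ[ℂ] H)) (hι : ∀ l g v, ι l (τ g v) = π g (ι l v))
    (hιn : ∀ l v w, ⟪ι l v, ι l w⟫_ℂ = ⟪v, w⟫_ℂ) (horth : ∀ l m, l ≠ m → ∀ v w, ⟪ι l v, ι m w⟫_ℂ = 0)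
    (hiso : ∀ e : V →ₗ[ℂ] H, (∀ g v, e (τ g v) = π g (e v)) →
      (∀ v, e v ∈ (⨆ l, LinearMap.range (ι l))ᗮ) → e = 0) (b a : V) (P Q : H →L[ℂ] ℂ)
    (h : TwoVectorPeriod.doublePeriod (RopTwo μ hτ hπ hc b a) P Q ≠ 0) :
    ∃ l, P (ι l a) ≠ 0 ∧ Q (ι l b) ≠ 0 := by
  rw [RopTwo_eq_sum_rankOne μ hτ hτu hτi hπ hc ι hι hιn horth hiso b a] at h
  obtain ⟨l, _, hl⟩ := exists_both_ne_zero_of_ne_zero Finset.univ (fun l => ι l b) (fun l => ι l a) P Q h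
  exact ⟨l, hl⟩

/-- **finite rank**: the range of `R(f)` lies in the span of the `ι l a` (the `u_A`-vectors of the copies). -/
theorem range_RopTwo_le_span [IsProbabilityMeasure μ] [μ.IsMulLeftInvariant] {τ : G →* (V →L[ℂ] V)}
    (hτ : Continuous τ) (hτu : SchurProjector.IsUnitaryRep τ) (hτi : IsIrreducible τ) {π : G →* (H →ₗ[ℂ] H)}
    (hπ : T7SupportWeightTorusOrbital.IsUnitaryRep π) (hc : ∀ x, Continuous fun g => π g x)
    (ι : L → (V →ₗ[ℂ] H)) (hι : ∀ l g v, ι l (τ g v) = π g (ι l v))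
    (hιn : ∀ l v w, ⟪ι l v, ι l w⟫_ℂ = ⟪v, w⟫_ℂ) (horth : ∀ l m, l ≠ m → ∀ v w, ⟪ι l v, ι m w⟫_ℂ = 0)
    (hiso : ∀ e : V →ₗ[ℂ] H, (∀ g v, e (τ g v) = π g (e v)) →
      (∀ v, e v ∈ (⨆ l, LinearMap.range (ι l))ᗮ) → e = 0) (b a : V) :
    LinearMap.range (RopTwo μ hτ hπ hc b a : H →ₗ[ℂ] H) ≤ Submodule.span ℂ (Set.range fun l => ι l a) := by
  rw [RopTwo_eq_sum_rankOne μ hτ hτu hτi hπ hc ι hι hιn horth hiso b a]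
  exact range_sum_rankOne_le_span Finset.univ (fun l => ι l b) (fun l => ι l a)

end Copies

end Summit.Ventures.HodgeRepro2.Tier7.Line3.TwoVectorIsotypic
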